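import Summits.ResolutionOfSingularities.ResolutionOfSingularities.Theorems.ValuativeLuAlphaPTorsorPthPowerModMonomial
import Literature.AlgebraicGeometry.Resolution.LocalBlowup

/-!
# Presentation of `locAtCentre A O` as a quotient of `k[X]_𝔮`
(crux `Valuative.LuAlphaPTorsor`, line `pfaff-line-log-final-forms`)

Stub `exists_presentation_locAtCentre` (U13) of the lead's skeleton for item
`stmt-ResolutionOfSingularities-0641`.

For a finitely generated `k`-subalgebra `A ⊆ O ⊆ K` of a valued field, the local ring
`locAtCentre A.toSubring O ⊆ K` of the model `A` at the centre `𝔪_O ∩ A` of the valuation is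
a quotient of a localized polynomial ring: there is a SURJECTIVE ring homomorphism
`Φq : k[X_1, …, X_n]_𝔮 ↠ locAtCentre A.toSubring O` for some prime `𝔮`.

Proof: compose the presentation `Φ : k[X] → A_𝔭` of `exists_presentation` (every element of
`A_𝔭` is `Φ F / Φ G` with `Φ G` a unit) with the ring isomorphism
`locAtCentreEquiv h : A_𝔭 ≃ locAtCentre A.toSubring O`; the "essential surjectivity" is
transported along the isomorphism, and `exists_surjective_lift` extends the composite to a
surjection from the localization at `𝔮 = Φ'⁻¹(𝔪)`.
-/

set_option linter.dupNamespace false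

namespace Summit.ResolutionOfSingularities.ResolutionOfSingularities.Theorems.PfaffLine

open IsLocalRing Literature.AlgebraicGeometry.Resolution

/-- **U13, presentation of the local ring of a finitely generated model.** For `A ⊆ O ⊆ K` a
finitely generated `k`-subalgebra of a valued field, the local ring `locAtCentre A.toSubring O`
(the localization of `A` at the centre `𝔪_O ∩ A`, realised inside `K`) is a quotient of a
localized polynomial ring: `Φq : k[X_1, …, X_n]_𝔮 ↠ locAtCentre A.toSubring O` surjective, for
some `n` and some prime ideal `𝔮`. [folklore] -/
theorem exists_presentation_locAtCentre : ∀ (k K : Type) [Field k] [Field K] [Algebra k K] (O : ValuationSubring K) (A : Subalgebra k K), A.toSubring ≤ O.toSubring → A.FG → ∃ (n : ℕ) (𝔮 : Ideal (MvPolynomial (Fin n) k)) (_ : 𝔮.IsPrime) (Φq : Localization.AtPrime 𝔮 →+* Literature.AlgebraicGeometry.Resolution.locAtCentre A.toSubring O), Function.Surjective Φq := by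
  intro k K _ _ _ O A h hfg
  obtain ⟨n, Φ, hΦ⟩ := exists_presentation O A h hfg
  -- the ring isomorphism `A_𝔭 ≃ locAtCentre A O`
  let e : Localization.AtPrime (Ideal.comap (Subring.inclusion h) (IsLocalRing.maximalIdeal O)) ≃+*
      locAtCentre A.toSubring O := (locAtCentreEquiv h).toRingEquiv
  haveI := isLocalRing_locAtCentre h
  -- the composite presentation `k[X] → locAtCentre A O`
  let Φ' : MvPolynomial (Fin n) k →+* locAtCentre A.toSubring O := e.toRingHom.comp Φ
  have hΦ' : ∀ r, ∃ F G, IsUnit (Φ' G) ∧ r * Φ' G = Φ' F := fun r => by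
    obtain ⟨F, G, hG, hr⟩ := hΦ (e.symm r)
    refine ⟨F, G, hG.map e.toRingHom, ?_⟩
    show r * e (Φ G) = e (Φ F)
    rw [← hr, map_mul, e.apply_symm_apply]
  obtain ⟨Φq, hsurj, -⟩ := exists_surjective_lift Φ' hΦ'
  exact ⟨n, Ideal.comap Φ' (maximalIdeal _), inferInstance, Φq, hsurj⟩

end Summit.ResolutionOfSingularities.ResolutionOfSingularities.Theorems.PfaffLine
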